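import Literature.NumberTheory.Automorphic.GKModulesAdmissibleUnitaryTwoOne        -- ★ Gelfand's trick at `U(2,1)` (`isAdmissibleGK_of_irreducible_unitary_uFormGroup_two_one`) and its two ★ ingredients
import Literature.NumberTheory.Automorphic.HasUnitaryGlobalizationOfInfUnitaryU21     -- ★ O2 `hasUnitaryGlobalization_of_isInfUnitary_uTwoOne`
import Literature.NumberTheory.Automorphic.GKInfinitesimallyUnitaryConverse           -- ★ O1 `isInfUnitary_of_isInfUnitaryAlongP`
import Literature.NumberTheory.Automorphic.UnitaryGlobalizationIrreducibleNoAdm        -- ★ `isTopIrreducible_of_isUnitaryGlobalization`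
import Literature.NumberTheory.Automorphic.ClosedCompactDecomposition                  -- ★ `isMulRightInvariant_of_compactSpace`, `isInvInvariant_of_compactSpace` (compact groups are unimodular)
import Summits.HodgeConjecture.HodgeConjecture.Theorems.F0P3bArchDegOnePackageDefs      -- ★ `IsCohUnitaryIrrep` (the 8b-αᵤ binder)
import HarnessLib

/-!
# K2-LIT E1b · 8b-αᵤ road, file 2b «K-TYPE MULTIPLICITY ONE»: every K-type of a coh-unitary irreducible `(𝔤, K)`-module of `U(2,1)` has multiplicity `≤ 1`

Cell `hodgecm-mathlib`, Track B «K2-LIT» (one theorem-group per file), squad K2, engine E1b (`GKCohomologyU21`, socket 8b-αᵤ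
`sig_K2E1bModelOfRecordCohUnitary`, census `K2/K2-defs1/g3/CENSUS-8b-alpha-ModelOfRecord.K2-defs1-g3.md` row **O3** «K-type multiplicity ≤ 1»
+ its glue through O1 ∕ O2); seat K2E4-p11 (g2), deal K2E1b-plan (g4) 2026-09-04T03:49:16Z (c) «file 2» (second half; first half = ★
`K2E1bU21KTypeStrings`).  PROOF-ONLY; no `def`, no instance declaration, no notation, no named fact, no `sorry`.

THE MATHEMATICS.  (§1) `Hom_K(τ, ·)` is transported along a `K`-equivariant linear isomorphism (Mathlib `Representation.IntertwiningMap.llcomp`), so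
its dimension is an invariant of `K`-isomorphism.  (§2) GELFAND'S TRICK, SHARP FORM [Kraljevic1973; finite-dimensionality: HarishChandra1953, Thms. 4–6]: for an irreducible
unitary strongly continuous representation `σ` of `U(2,1)` on a Hilbert space and an irreducible `K`-type `τ` (`K ≅ U(2) × U(1)`),
`dim Hom_K(τ, H_K^∞(σ)) ≤ 1` — this is EXACTLY the proof of ★ `isAdmissibleGK_of_irreducible_unitary_uFormGroup_two_one` (the orbital operators of
`σ` commute, ★ `commute_orbitalOp_uFormGroup_two_one`; hence the multiplicity space of the realised `K`-type `τ′ ⊂ E` is a line, ★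
`exists_forall_homSpace_eq_smul_of_commute_orbitalOp`; and `Hom_K(τ, H_K^∞) ↪ Hom_K(τ′, σ|_K)` linearly), whose last line there only recorded
finite-dimensionality; here the same injection is read with `finrank`.  (§3) THE 8b-αᵤ GLUE (census O1 → O2 → O3): a coh-unitary irreducible admissible
`(𝔤, K)`-module `r` of `U(2,1)` (★ `IsCohUnitaryIrrep`: unitary along `𝔭 ⊕ ℝz₀`) is infinitesimally unitary (★ O1 `isInfUnitary_of_isInfUnitaryAlongP`), so
it has a unitary Hilbert globalization `ϖ` (★ O2 `hasUnitaryGlobalization_of_isInfUnitary_uTwoOne`), which is topologically irreducible (★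
`isTopIrreducible_of_isUnitaryGlobalization`) and whose Harish-Chandra module is `(𝔤, K)`-isomorphic to `r` (★ `IsUnitaryGlobalization`, ★
`GKIrrClass.mk_eq_mk_iff`); §2 for `ϖ` and §1 along that isomorphism give `dim Hom_K(τ, r) ≤ 1` for every irreducible `K`-type `τ` — every
`V_{n,m}` of `r` is ONE `𝔰𝔩₂`-string (file 2a).

HONEST LABEL: kernel theorems about `(𝔤, K)`-modules of `U(2,1)`; a helper of the 8b-αᵤ road, it closes no socket by itself.  HC_CM is proved only modulo
the 7 printed citations (2 remaining named inputs: hLiu418 = stmt-HodgeConjecture-24832, h413 = stmt-HodgeConjecture-24833) until rung 0 closes.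

## References
* H. Kraljević, *Representations of the universal covering group of the group SU(n,1)*, Glasnik Mat. 8(28) (1973) 23–72. [Kraljevic1973]
* Harish-Chandra, *Representations of a semisimple Lie group on a Banach space. I*, Trans. AMS 75 (1953), Thms. 4–6. [HarishChandra1953]
* A. W. Knapp, D. A. Vogan, *Cohomological Induction and Unitary Representations* (1995), Introduction Thm. 0.6, §II.4. [KnappVogan1995]
* D. Kovačević, *Unitary representations of SU(2,1) …* (2021), §3 (multiplicity one is assumed there, p0005 L83). [Kovacevic2021]
-/

-- Mathlib idiom (as in ★ `GKModules` and every `(𝔤, K)` file of the tree): the commutator bracket on `Module.End ℂ V`, needed to MENTION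
-- `r.ρ𝔤 : (uFormGroup (Fin 2) (Fin 1)).lie →ₗ⁅ℝ⁆ Module.End ℂ r.V` (`LieRing.ofAssociativeRing` is a `def` in Mathlib).
attribute [local instance 100] LieRing.ofAssociativeRing

set_option autoImplicit false
set_option linter.dupNamespace false

noncomputable section

open MeasureTheory Measure ContRepresentation
open Literature.RepresentationTheory Literature.RepresentationTheory.CompactGroups Literature.RepresentationTheory.KonnoKonno2007
open Literature.RepresentationTheory.KonnoKonno2007.RealDualPair Literature.RepresentationTheory.BorelWallach2000
open Literature.NumberTheory.Automorphic
open Summit.HodgeConjecture.HodgeConjecture.Cruxes.H413.F0P3bArchDegOnePackage (IsCohUnitaryIrrep)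
open scoped InnerProductSpace

namespace Summit.HodgeConjecture.HodgeConjecture.Cruxes.H413.K2E1bU21KTypeMultiplicityOne


/-! ## §1 `Hom_K(τ, ·)` along a `K`-equivariant isomorphism -/

/-- **`dim Hom_K(τ, V) = dim Hom_K(τ, V′)` for `K`-isomorphic `V ≃ V′`** (and finite-dimensionality transfers): composition with the
isomorphism, Mathlib `IntertwiningMap.llcomp`. [folklore] [cite: KnappVogan1995, §II.4] -/
theorem finrank_intertwiningMap_eq_of_equivariant {Kg : Type*} [Group Kg] {V V' W : Type*} [AddCommGroup V] [Module ℂ V]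
    [AddCommGroup V'] [Module ℂ V'] [AddCommGroup W] [Module ℂ W] (ρ : Representation ℂ Kg V) (ρ' : Representation ℂ Kg V')
    (τ : Representation ℂ Kg W) (e : V ≃ₗ[ℂ] V') (he : ∀ (k : Kg) (v : V), e (ρ k v) = ρ' k (e v))
    [FiniteDimensional ℂ (τ.IntertwiningMap ρ')] :
    FiniteDimensional ℂ (τ.IntertwiningMap ρ) ∧ Module.finrank ℂ (τ.IntertwiningMap ρ) = Module.finrank ℂ (τ.IntertwiningMap ρ') := by
  -- the `K`-isomorphism as a Mathlib `Representation.Equiv`, and composition with it (both ways) on `Hom_K(τ, ·)`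
  have he' : ∀ k : Kg, (e : V →ₗ[ℂ] V') ∘ₗ ρ k = ρ' k ∘ₗ (e : V →ₗ[ℂ] V') := fun k => LinearMap.ext fun v => he k v
  let E : ρ.Equiv ρ' := Representation.Equiv.mk e he'
  let Φ : τ.IntertwiningMap ρ ≃ₗ[ℂ] τ.IntertwiningMap ρ' :=
    { toFun := fun j => E.toIntertwiningMap.comp j
      invFun := fun j => E.symm.toIntertwiningMap.comp j
      map_add' := fun j j' => Representation.IntertwiningMap.ext (LinearMap.ext fun w => by
        simp only [Representation.IntertwiningMap.comp_toLinearMap, Representation.IntertwiningMap.add_toLinearMap, LinearMap.comp_add])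
      map_smul' := fun c j => Representation.IntertwiningMap.ext (LinearMap.ext fun w => by
        simp only [Representation.IntertwiningMap.comp_toLinearMap, Representation.IntertwiningMap.toLinearMap_smul, LinearMap.comp_smul,
          RingHom.id_apply])
      left_inv := fun j => Representation.IntertwiningMap.ext (LinearMap.ext fun w => by
        simp only [Representation.IntertwiningMap.comp_toLinearMap, LinearMap.comp_apply, Representation.IntertwiningMap.toLinearMap_apply,
          Representation.Equiv.coe_toIntertwiningMap, Representation.Equiv.symm_apply_apply])
      right_inv := fun j => Representation.IntertwiningMap.ext (LinearMap.ext fun w => by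
        simp only [Representation.IntertwiningMap.comp_toLinearMap, LinearMap.comp_apply, Representation.IntertwiningMap.toLinearMap_apply,
          Representation.Equiv.coe_toIntertwiningMap, Representation.Equiv.apply_symm_apply]) }
  exact ⟨Module.Finite.equiv Φ.symm, Φ.finrank_eq⟩

/-! ## §2 Gelfand's trick, sharp form: `dim Hom_K(τ, H_K^∞(σ)) ≤ 1` for irreducible unitary `σ` of `U(2,1)` -/

/-- **K-TYPE MULTIPLICITY ONE FOR IRREDUCIBLE UNITARY REPRESENTATIONS OF `U(2,1)`** (Gelfand's trick for the transpose): for an irreducible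
unitary strongly continuous `σ` on a Hilbert space and an irreducible `K`-type `τ`, `dim_ℂ Hom_K(τ, H_K^∞(σ)) ≤ 1`.  The proof is that of ★
`isAdmissibleGK_of_irreducible_unitary_uFormGroup_two_one` verbatim (★ `commute_orbitalOp_uFormGroup_two_one` + ★
`exists_forall_homSpace_eq_smul_of_commute_orbitalOp` + the linear injection `Hom_K(τ, H_K^∞) ↪ Hom_K(τ′, σ|_K)`), read with `finrank`;
finite-dimensionality is Harish-Chandra's admissibility, the bound `≤ 1` is Kraljević's multiplicity-one theorem for `(U(n,1), U(n) × U(1))`.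
[cite: HarishChandra1953, Thms. 4–6 (finite multiplicity)] [cite: Kraljevic1973, Thm. (the K-types of the irreducible unitary representations of SU(n,1) have multiplicity one), pp. 23–72] -/
theorem finrank_intertwiningMap_harishChandraRepK_le_one {E : Type} [NormedAddCommGroup E] [InnerProductSpace ℂ E] [CompleteSpace E]
    (σ : ContRepresentation ℂ (uFormGroup (Fin 2) (Fin 1)).carrier E) (hU : σ.IsUnitary) (hc : σ.IsStronglyContinuous)
    (hirr : σ.IsTopIrreducible) {W : Type} [AddCommGroup W] [Module ℂ W] [FiniteDimensional ℂ W]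
    (τ : Representation ℂ (uFormGroup (Fin 2) (Fin 1)).maximalCompact W) (hτ : τ.IsIrreducible) :
    FiniteDimensional ℂ (τ.IntertwiningMap (harishChandraRepK (uFormGroup (Fin 2) (Fin 1)) σ)) ∧
      Module.finrank ℂ (τ.IntertwiningMap (harishChandraRepK (uFormGroup (Fin 2) (Fin 1)) σ)) ≤ 1 := by
  classical
  haveI := hτ
  /- (1) the compact group `K₀ = U(2) × U(1)`, its Haar probability measure, and its embedding `ιK` into `U(2,1)` -/
  haveI : CompactSpace ↥(Matrix.unitaryGroup (Fin 2) ℂ) := isCompact_iff_compactSpace.mp Matrix.isCompact_unitaryGroup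
  haveI : CompactSpace ↥(Matrix.unitaryGroup (Fin 1) ℂ) := isCompact_iff_compactSpace.mp Matrix.isCompact_unitaryGroup
  haveI : SecondCountableTopology (Matrix (Fin 2) (Fin 2) ℂ) := inferInstanceAs (SecondCountableTopology (Fin 2 → Fin 2 → ℂ))
  haveI : SecondCountableTopology (Matrix (Fin 1) (Fin 1) ℂ) := inferInstanceAs (SecondCountableTopology (Fin 1 → Fin 1 → ℂ))
  haveI : SecondCountableTopology ↥(Matrix.unitaryGroup (Fin 2) ℂ) := TopologicalSpace.Subtype.secondCountableTopology _
  haveI : SecondCountableTopology ↥(Matrix.unitaryGroup (Fin 1) ℂ) := TopologicalSpace.Subtype.secondCountableTopology _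
  haveI : SecondCountableTopology (KV (Fin 2) (Fin 1)) := inferInstance
  letI : MeasurableSpace (KV (Fin 2) (Fin 1)) := borel _
  haveI : BorelSpace (KV (Fin 2) (Fin 1)) := ⟨rfl⟩
  set μ : Measure (KV (Fin 2) (Fin 1)) := haarMeasure ⊤ with hμ
  haveI : IsProbabilityMeasure μ := ⟨by rw [hμ, ← TopologicalSpace.PositiveCompacts.coe_top]; exact haarMeasure_self⟩
  haveI : T2Space (KV (Fin 2) (Fin 1)) := inferInstance
  haveI : IsHaarMeasure μ := by rw [hμ]; infer_instance
  haveI : μ.IsMulRightInvariant := isMulRightInvariant_of_compactSpace μ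
  haveI : μ.IsInvInvariant := isInvInvariant_of_compactSpace μ
  set ιK : KV (Fin 2) (Fin 1) →* ↥(uFormGroup (Fin 2) (Fin 1)).carrier :=
    (Subgroup.inclusion (uFormGroup (Fin 2) (Fin 1)).maximalCompact_le_carrier).comp
      (upqMaximalCompactEquiv (α := Fin 2) (β := Fin 1)).symm.toMulEquiv.toMonoidHom with hιK
  have hι : Continuous ιK :=
    (Continuous.subtype_mk continuous_subtype_val _).comp (upqMaximalCompactEquiv (α := Fin 2) (β := Fin 1)).symm.continuous
  /- (2) Gelfand's trick: the orbital operators of `σ` commute -/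
  have hcomm : ∀ x y : ↥(uFormGroup (Fin 2) (Fin 1)).carrier,
      Commute (orbitalOp μ ιK σ hι hc hU x) (orbitalOp μ ιK σ hι hc hU y) :=
    commute_orbitalOp_uFormGroup_two_one (β := Fin 1) μ σ hc hU hι
  /- (3) the `K`-type: either no non-zero intertwiner, or realise `τ` inside `E` -/
  by_cases h0 : ∀ j : τ.IntertwiningMap (harishChandraRepK (uFormGroup (Fin 2) (Fin 1)) σ), j = 0
  · haveI : Subsingleton (τ.IntertwiningMap (harishChandraRepK (uFormGroup (Fin 2) (Fin 1)) σ)) :=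
      ⟨fun a b => (h0 a).trans (h0 b).symm⟩
    refine ⟨Module.Finite.of_surjective
      (LinearMap.toSpanSingleton ℂ (τ.IntertwiningMap (harishChandraRepK (uFormGroup (Fin 2) (Fin 1)) σ)) 0)
      fun j => ⟨0, by rw [h0 j, LinearMap.toSpanSingleton_apply, zero_smul]⟩, ?_⟩
    rw [Module.finrank_zero_of_subsingleton]
    exact zero_le_one
  push Not at h0
  obtain ⟨j₀, hj₀⟩ := h0
  have hj₀inj : Function.Injective j₀ := (Representation.IsIrreducible.injective_or_eq_zero j₀).resolve_right hj₀
  -- the realisation `f = incl ∘ j₀ : W → E`, its range `U₀` and the transport `e₀ : W ≃ U₀`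
  let f : W →ₗ[ℂ] E := (harishChandraSpace (uFormGroup (Fin 2) (Fin 1)) σ).subtype ∘ₗ j₀.toLinearMap
  have hfapply : ∀ w, f w = ((j₀ w : harishChandraSpace (uFormGroup (Fin 2) (Fin 1)) σ) : E) := fun w => rfl
  have hfinj : Function.Injective f := Subtype.val_injective.comp hj₀inj
  let U₀ : Submodule ℂ E := LinearMap.range f
  let e₀ : W ≃ₗ[ℂ] ↥U₀ := LinearEquiv.ofInjective f hfinj
  have he₀apply : ∀ w, ((e₀ w : ↥U₀) : E) = f w := fun w => LinearEquiv.ofInjective_apply f (h := hfinj) w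
  -- equivariance of `f` along `ιK`
  have hfK : ∀ (k : KV (Fin 2) (Fin 1)) (w : W),
      σ (ιK k) (f w) = f (τ ((upqMaximalCompactEquiv (α := Fin 2) (β := Fin 1)).symm k) w) := by
    intro k w
    rw [hfapply, hfapply, j₀.isIntertwining]
    rfl
  -- `U₀` is `K`-stable: a closed subrepresentation of `σ ∘ ιK`
  have hU₀K : ∀ (k : KV (Fin 2) (Fin 1)) {u : E}, u ∈ U₀ → (σ.restrict ιK) k u ∈ U₀ := by
    rintro k _ ⟨w, rfl⟩
    exact ⟨τ ((upqMaximalCompactEquiv (α := Fin 2) (β := Fin 1)).symm k) w, (hfK k w).symm⟩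
  let Uc : ClosedSubrep (σ.restrict ιK) :=
    { toSubmodule := U₀
      apply_mem_toSubmodule := fun k u hu => hU₀K k hu
      isClosed' := Submodule.closed_of_finiteDimensional U₀ }
  let τ' : ContRepresentation ℂ (KV (Fin 2) (Fin 1)) ↥U₀ := Uc.toContRep
  have hτ'apply : ∀ (k : KV (Fin 2) (Fin 1)) (u : ↥U₀), ((τ' k u : ↥U₀) : E) = σ (ιK k) (u : E) := fun k u => rfl
  let ρ' : Representation ℂ (KV (Fin 2) (Fin 1)) ↥U₀ := τ'.toRepresentation
  have hρ'apply : ∀ (k : KV (Fin 2) (Fin 1)) (u : ↥U₀), ρ' k u = τ' k u := fun k u => rfl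
  -- `e₀` is equivariant along `K ≃ U(2) × U(1)`
  have he : ∀ (k : ↥(uFormGroup (Fin 2) (Fin 1)).maximalCompact) (w : W),
      e₀ (τ k w) = ρ' ((upqMaximalCompactEquiv (α := Fin 2) (β := Fin 1)) k) (e₀ w) := by
    intro k w
    rw [hρ'apply]
    apply Subtype.ext
    rw [hτ'apply, he₀apply, he₀apply, hfK, ContinuousMulEquiv.symm_apply_apply]
  -- `τ'` is irreducible and unitary
  haveI : ρ'.IsIrreducible :=
    (Representation.isIrreducible_iff_of_equivariant τ ρ'
      (upqMaximalCompactEquiv (α := Fin 2) (β := Fin 1)).toMulEquiv.toMonoidHom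
      (upqMaximalCompactEquiv (α := Fin 2) (β := Fin 1)).surjective e₀ he).mp hτ
  have hτ'u : ∀ (k : KV (Fin 2) (Fin 1)) (v w : ↥U₀), ⟪τ' k v, τ' k w⟫_ℂ = ⟪v, w⟫_ℂ := by
    intro k v w
    rw [Submodule.coe_inner, Submodule.coe_inner, hτ'apply, hτ'apply]
    exact hU.inner_map_map _ _ _
  /- (4) multiplicity one in the multiplicity space of `τ'` -/
  obtain ⟨S₀, hS₀⟩ := exists_forall_homSpace_eq_smul_of_commute_orbitalOp (τ := τ') hirr hcomm hτ'u
  haveI : FiniteDimensional ℂ (HomSpace τ' (σ.restrict ιK)) :=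
    Module.Finite.of_surjective (LinearMap.toSpanSingleton ℂ (HomSpace τ' (σ.restrict ιK)) S₀) fun S => by
      obtain ⟨c, hcS⟩ := hS₀ S
      exact ⟨c, by rw [LinearMap.toSpanSingleton_apply, hcS]⟩
  /- (5) `Hom_K(τ, H_K^∞) ↪ Hom_K(τ', σ ∘ ιK)`, `j ↦ incl ∘ j ∘ e₀⁻¹` -/
  have hmem : ∀ j : τ.IntertwiningMap (harishChandraRepK (uFormGroup (Fin 2) (Fin 1)) σ),
      LinearMap.toContinuousLinearMap
          ((harishChandraSpace (uFormGroup (Fin 2) (Fin 1)) σ).subtype ∘ₗ j.toLinearMap ∘ₗ (e₀.symm : ↥U₀ →ₗ[ℂ] W)) ∈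
        Schur.intertwiners τ' (σ.restrict ιK) := by
    intro j k
    refine ContinuousLinearMap.ext fun u => ?_
    -- `u = e₀ w`
    obtain ⟨w, rfl⟩ : ∃ w, u = e₀ w := ⟨e₀.symm u, (e₀.apply_symm_apply u).symm⟩
    have hk : τ' k (e₀ w) = e₀ (τ ((upqMaximalCompactEquiv (α := Fin 2) (β := Fin 1)).symm k) w) := by
      rw [he, ContinuousMulEquiv.apply_symm_apply, hρ'apply]
    change (σ.restrict ιK) k (((j (e₀.symm (e₀ w)) : harishChandraSpace (uFormGroup (Fin 2) (Fin 1)) σ) : E)) =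
      ((j (e₀.symm (τ' k (e₀ w))) : harishChandraSpace (uFormGroup (Fin 2) (Fin 1)) σ) : E)
    rw [hk, LinearEquiv.symm_apply_apply, LinearEquiv.symm_apply_apply, j.isIntertwining]
    rfl
  let Φ : τ.IntertwiningMap (harishChandraRepK (uFormGroup (Fin 2) (Fin 1)) σ) →ₗ[ℂ] HomSpace τ' (σ.restrict ιK) :=
    { toFun := fun j => HomSpace.mk _ (hmem j)
      map_add' := fun j j' => HomSpace.ext (ContinuousLinearMap.ext fun u => rfl)
      map_smul' := fun c j => HomSpace.ext (ContinuousLinearMap.ext fun u => rfl) }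
  have hΦapply : ∀ (j : τ.IntertwiningMap (harishChandraRepK (uFormGroup (Fin 2) (Fin 1)) σ)) (w : W),
      (Φ j).toCLM (e₀ w) = ((j w : harishChandraSpace (uFormGroup (Fin 2) (Fin 1)) σ) : E) := by
    intro j w
    change ((j (e₀.symm (e₀ w)) : harishChandraSpace (uFormGroup (Fin 2) (Fin 1)) σ) : E) = _
    rw [LinearEquiv.symm_apply_apply]
  have hΦinj : Function.Injective Φ := by
    intro j j' hjj'
    apply Representation.IntertwiningMap.toLinearMap_injective
    refine LinearMap.ext fun w => ?_
    have hw := congrArg (fun T : HomSpace τ' (σ.restrict ιK) => T.toCLM (e₀ w)) hjj'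
    simp only [hΦapply] at hw
    exact Subtype.ext hw
  haveI hfd : FiniteDimensional ℂ (τ.IntertwiningMap (harishChandraRepK (uFormGroup (Fin 2) (Fin 1)) σ)) :=
    FiniteDimensional.of_injective Φ hΦinj
  refine ⟨hfd, ?_⟩
  calc Module.finrank ℂ (τ.IntertwiningMap (harishChandraRepK (uFormGroup (Fin 2) (Fin 1)) σ))
      ≤ Module.finrank ℂ (HomSpace τ' (σ.restrict ιK)) := LinearMap.finrank_le_finrank_of_injective hΦinj
    _ ≤ 1 := finrank_le_one S₀ fun S => by
        obtain ⟨c, hcS⟩ := hS₀ S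
        exact ⟨c, hcS.symm⟩

/-! ## §3 The 8b-αᵤ glue: multiplicity one for coh-unitary irreducible `(𝔤, K)`-modules -/

/-- **EVERY K-TYPE OF A COH-UNITARY IRREDUCIBLE `(𝔤, K)`-MODULE OF `U(2,1)` HAS MULTIPLICITY `≤ 1`** (census O3 through O1 ∕ O2): for
`r : GKIrrep U(2,1)` with ★ `IsCohUnitaryIrrep r.ρK r.ρ𝔤` and every irreducible finite-dimensional `K`-representation `τ`,
`Hom_K(τ, r)` is finite-dimensional of dimension `≤ 1` — ★ O1 `isInfUnitary_of_isInfUnitaryAlongP` → ★ O2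
`hasUnitaryGlobalization_of_isInfUnitary_uTwoOne` → ★ `isTopIrreducible_of_isUnitaryGlobalization` → §2 → §1 along the globalization's
`(𝔤, K)`-isomorphism (★ `IsUnitaryGlobalization`, ★ `GKIrrClass.mk_eq_mk_iff`).  (Kovačević ASSUMES this, §3 p0005 L83; here it is proved for the
coh-unitary case.) [cite: Kraljevic1973, Thm. (the K-types of the irreducible unitary representations of SU(n,1) have multiplicity one), pp. 23–72]
[cite: HarishChandra1953, Thms. 4–6 (finite multiplicity)] [cite: KnappVogan1995, Introduction Thm. 0.6 (a)] [cite: Kovacevic2021, §3 Remark 1] -/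
theorem finrank_intertwiningMap_le_one_of_isCohUnitaryIrrep (r : GKIrrep (uFormGroup (Fin 2) (Fin 1))) (hr : IsCohUnitaryIrrep r.ρK r.ρ𝔤)
    {W : Type} [AddCommGroup W] [Module ℂ W] [FiniteDimensional ℂ W] (τ : Representation ℂ (uFormGroup (Fin 2) (Fin 1)).maximalCompact W)
    (hτ : τ.IsIrreducible) :
    FiniteDimensional ℂ (τ.IntertwiningMap r.ρK) ∧ Module.finrank ℂ (τ.IntertwiningMap r.ρK) ≤ 1 := by
  -- O1: coh-unitary ⇒ infinitesimally unitary; O2: a unitary Hilbert globalization `ϖ` of the class of `r`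
  have hu : Liu2021.LemD2.IsInfUnitary r.ρK r.ρ𝔤 := isInfUnitary_of_isInfUnitaryAlongP hr.gk hr.unit
  obtain ⟨g⟩ := hasUnitaryGlobalization_of_isInfUnitary_uTwoOne r hr.adm hu
  have hϖ := g.isUnitaryGlobalization
  have hirrϖ : g.ϖ.IsTopIrreducible := isTopIrreducible_of_isUnitaryGlobalization (GKIrrClass.mk r) hϖ
  obtain ⟨hUϖ, hc, r', hr', ⟨e₁⟩⟩ := hϖ
  obtain ⟨e₂⟩ := (GKIrrClass.mk_eq_mk_iff r' r).mp hr'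
  -- §2 for `ϖ`: `dim Hom_K(τ, H_K^∞(ϖ)) ≤ 1` (and it is finite-dimensional, ★ Harish-Chandra admissibility at `U(2,1)`)
  have h2 := finrank_intertwiningMap_harishChandraRepK_le_one g.ϖ hUϖ hc hirrϖ τ hτ
  -- `Hom_K(τ, r)` is finite-dimensional (admissibility) and `K`-isomorphic to `Hom_K(τ, H_K^∞(ϖ))` along `e₂ ∘ e₁`
  haveI hfin : FiniteDimensional ℂ (τ.IntertwiningMap r.ρK) := hr.adm W τ hτ
  obtain ⟨-, heq⟩ := finrank_intertwiningMap_eq_of_equivariant (harishChandraRepK (uFormGroup (Fin 2) (Fin 1)) g.ϖ) r.ρK τ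
    (e₁.toLinearEquiv.trans e₂.toLinearEquiv) (fun k v => by rw [LinearEquiv.trans_apply, LinearEquiv.trans_apply, e₁.map_ρK, e₂.map_ρK])
  exact ⟨hfin, heq ▸ h2.2⟩

end Summit.HodgeConjecture.HodgeConjecture.Cruxes.H413.K2E1bU21KTypeMultiplicityOne

end
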